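import Mathlib
import Summits.ResolutionOfSingularities.ResolutionOfSingularities.Theorems.WeightedInvariantLocalWeightedDropNCResSurfGraphStep
import Summits.ResolutionOfSingularities.ResolutionOfSingularities.Theorems.WeightedInvariantLocalWeightedDropNCResSurfGraphChart
import Summits.ResolutionOfSingularities.ResolutionOfSingularities.Theorems.WeightedInvariantLocalWeightedDropNCResCurveGraphLoop

/-!
# `WeightedInvariant.LocalWeightedDrop`: NC-resolution settings for the TOT₂ line — GRAPH SURFACES, part 7: THE SUCCESSOR OF THE POINT MOVE IS
# AGAIN A PERMISSIBLE GRAPH SURFACE (the transform of the product through the strict transform of the surface)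

Crux item stmt-ResolutionOfSingularities-8899 `LocalWeightedDrop` (route `ResolutionOfSingularities/WeightedInvariant`), ENGINE skeleton v32/v33, residuals
`stub_spaceNCRankDrop` / `stub_wildWideApexFourStartsWon` (res-L1-w43-strat-1's line `directrix-cut` v3.1, piece PL = `ApexPlaneExit`, SURFACE sub-case;
design memo `L/res-L1-w43-stub-4/g5/S-E2-SURF.md`).  [OURS · L1 W4.3 · chain w43 · seat res-L1-w43-stub-4 gen 5; def-free on parts 1–6 and on
res-L1-w43-stub-1's S-SET (`Decoration.totalO_chart_eq`, `Decoration.prod_X_newLetters`, `…CurveGraphStep`'s head bookkeeping); the surface twin of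
res-L1-w43-stub-1's `GraphCurve.inOffIdeal_transform` (…NCResCurveGraphLoop), same proof; the count game is the programme's own; nothing here is a
statement of any manuscript; AI-produced, gate-checked, weaker than expert review.]

* **`inOffPlaneIdeal_transform`** — from an admissibly decorated `(b₀, δ)` with product `g = f·∏_O x_l` permissible along the graph surface
  `(a, b, ψ)` (`shear_{a,b}(ψ)^* g ∈ (x_j : j ∉ {a,b})^c`), at an answer `c′ = c′_a•tangentL + c′_b•tangentR` of the identity point move with `c′_a ≠ 0`
  (read at the slot `a`) and unchanged head: the successor's product `g′ = f′·∏_{O′} x_l` is permissible along the successor graph surface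
  `(b′, 0, step₂ a b ψ c′)`: `shear_{b′,0}(step₂)^* g′ ∈ (y_{j′} : j′ ∉ {b′, 0})^{c}` — part 6's (C3) on the restricted chart image
  `s^c · U · g′` of `g`, then strip `s^c` (a BASE letter now) and the unit.
-/

set_option linter.dupNamespace false -- mandated namespace of this single-conjunct summit

noncomputable section

namespace Summit.ResolutionOfSingularities.ResolutionOfSingularities.Theorems

namespace TameFourTupleDrop

namespace GraphSurf

open MvPowerSeries Literature.AlgebraicGeometry.Resolution

variable {k : Type} [Field k] {m : ℕ}

/-- **THE SUCCESSOR OF THE POINT MOVE IS A PERMISSIBLE GRAPH SURFACE** (OURS · L1 W4.3; S-E2-SURF, the point-move step assembled on decorated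
states).  See the module docstring. -/
theorem inOffPlaneIdeal_transform {b₀ : MvPowerSeries (Fin (m + 1)) k} {δ : Decoration k m} {a b : Fin (m + 1)} (hab : a ≠ b)
    {ψ : Fin (m + 1) → MvPowerSeries (Fin 2) k} {c' : Fin (m + 1) → k} (hadm : Admissible b₀ δ)
    (hψ : ∀ j, ¬ (j = a ∨ j = b) → constantCoeff (ψ j) = 0)
    (hperm : InOffPlaneIdeal a b δ.c (subst (shear a b ψ) (δ.f * ∏ l ∈ δ.O, X l)))
    (hc' : c' = c' a • tangentL a b ψ + c' b • tangentR a b ψ) (hca : c' a ≠ 0)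
    (hhead : (δ.transform (fun j => (X j : MvPowerSeries (Fin (m + 1)) k)) (fun _ => 1) c' a).head = δ.head) :
    InOffPlaneIdeal (Fin.predAbove a b.succ) 0 (δ.transform (fun j => (X j : MvPowerSeries (Fin (m + 1)) k)) (fun _ => 1) c' a).c
      (subst (shear (Fin.predAbove a b.succ) 0 (step₂ a b ψ c'))
        ((δ.transform (fun j => (X j : MvPowerSeries (Fin (m + 1)) k)) (fun _ => 1) c' a).f *
          ∏ l ∈ (δ.transform (fun j => (X j : MvPowerSeries (Fin (m + 1)) k)) (fun _ => 1) c' a).O, X l)) := by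
  classical
  set δ' := δ.transform (fun j => (X j : MvPowerSeries (Fin (m + 1)) k)) (fun _ => 1) c' a with hδ'
  have hf : δ.f ≠ 0 := hadm.2.1.ne_zero
  have hpermX := isBPermissible_point_X δ
  have hconv : ∀ l, (fun _ : Fin (m + 1) => (1 : ℕ)) l = 0 → c' l = 0 := fun _ h => absurd h one_ne_zero
  have hXg : subst (fun j => (X j : MvPowerSeries (Fin (m + 1)) k)) (δ.f * ∏ l ∈ δ.O, X l) = δ.f * ∏ l ∈ δ.O, X l :=
    congrFun subst_self _
  -- the product through the chart: `g(chart) = s^c · H`, `H|_{y_a=0} = U · (strict · ∏ new old letters) = U · g′`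
  obtain ⟨H, U, hfacH, hH, hU, hsl⟩ := Decoration.totalO_chart_eq hpermX hconv hf hca
  rw [hXg] at hfacH
  have ho : δ'.o = δ.o := GraphCurve.o_transform_eq_of_head_eq hhead
  have hc : δ'.c = δ.c := GraphCurve.c_transform_eq_of_head_eq hhead
  have hfstrict : δ'.f = δ.strict (fun j => (X j : MvPowerSeries (Fin (m + 1)) k)) (fun _ => 1) c' a :=
    Decoration.transform_f_eq_strict_of_o_transform_eq hpermX hconv hf hca ho
  have hO : δ'.O = Decoration.newLetters δ.O (fun j => (X j : MvPowerSeries (Fin (m + 1)) k)) c' a :=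
    GraphCurve.O_transform_eq_of_head_eq hhead
  have hg' : TupleGame.slice a H = U * (δ'.f * ∏ l ∈ δ'.O, X l) := by
    rw [hsl, hfstrict, hO, Decoration.prod_X_newLetters hpermX c' hca δ.O_subset]
  -- the restricted chart image of `g` is `s^c · H|_{y_a = 0}`
  have hrestr := SliceChart.subst_restrictedChart (fun _ : Fin (m + 1) => 1) c' hconv (δ.f * ∏ l ∈ δ.O, X l) δ.c H hfacH a
  have hρ : (fun l : Fin (m + 1) => X 0 ^ ((fun _ : Fin (m + 1) => (1 : ℕ)) l) * (C (c' l) +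
      if l = a then (0 : MvPowerSeries (Fin (m + 1)) k) else X (Fin.predAbove a l.succ))) =
      fun l : Fin (m + 1) => X 0 * (C (c' l) + if l = a then (0 : MvPowerSeries (Fin (m + 1)) k) else X (Fin.predAbove a l.succ)) := by
    funext l; rw [pow_one]
  rw [hρ] at hrestr
  have hslice_eq : subst (fun j : Fin (m + 1 + 1) => if j = a.succ then (0 : MvPowerSeries (Fin (m + 1)) k) else X (Fin.predAbove a j)) H =
      TupleGame.slice a H := rfl
  rw [hslice_eq, hg'] at hrestr
  -- the chart step (part 6): permissibility of the successor graph surface for the restricted chart image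
  have hstep := inOffPlaneIdeal_chart_step₂ hab hperm hψ (fun j hj => answer_apply_of_eq_combo_tangent hc' hj)
  rw [hrestr] at hstep
  -- strip `s^c` (a base letter of the successor surface) and the unit
  have hsh0 := constantCoeff_step₂_of_ne ψ (fun j hj => answer_apply_of_eq_combo_tangent hc' hj)
  have hss : HasSubst (shear (Fin.predAbove a b.succ) 0 (step₂ a b ψ c')) := hasSubst_shear hsh0
  rw [← coe_substAlgHom hss, map_mul, map_mul, map_pow, coe_substAlgHom, subst_X hss, shear_of_base (Or.inr rfl)] at hstep
  have hU' : constantCoeff (subst (shear (Fin.predAbove a b.succ) 0 (step₂ a b ψ c')) U) ≠ 0 := by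
    rw [TOT2E1.constantCoeff_subst_of_constantCoeff_zero _ (constantCoeff_shear hsh0)]; exact hU
  have h1 := InOffPlaneIdeal.of_X_pow_mul_base (a := Fin.predAbove a b.succ) (b := (0 : Fin (m + 1))) (Or.inr rfl) hstep
  have h2 := h1.mul_left (subst (shear (Fin.predAbove a b.succ) 0 (step₂ a b ψ c')) U)⁻¹
  rw [← mul_assoc, MvPowerSeries.inv_mul_cancel _ hU', one_mul] at h2
  rw [hc]
  exact h2

end GraphSurf

end TameFourTupleDrop

end Summit.ResolutionOfSingularities.ResolutionOfSingularities.Theorems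

end
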